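import Literature.Computability.AlgebraicComplexity.FSV18OccurTopFanIn
import Literature.RepresentationTheory.AlgebraicGroups.CayleyOmegaProcess
import HarnessLib

/-!
# [ASSS16] Lemma 4.1 ("gcd trick" / `lem:derivative-content`) on the FSV occur-`k` formula model

Agrawal–Saha–Saptharishi–Saxena, *Jacobian hits circuits* [ASSS16] (arXiv:1111.0582; STOC 2012),
§4 and Appendix §7.3: the structural half of the hitting-set construction for depth-`D` occur-`k`
formulas, stated on the tree's syntax `OccurFormula` / `OccurArgs` / `OccurPowArgs` (FSV 2018
Def. 45, `Literature.Computability.AlgebraicComplexity.FSV18SuccinctGenerators`) with the iterated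
partial derivative `Δ_S := iterPderiv β` of
`Literature.RepresentationTheory.AlgebraicGroups.CayleyOmegaProcess` (`S ↔ β : ι →₀ ℕ`,
`var(S) = β.support`; the cell's agreed choice, val-lit bus 2026-08-26 16:48Z).

Printed statement (Lemma 4.1, p0009:L53–L66 = `lem:derivative-content`, p0018:L30–L41): "Let `G` be
any gate in `C` and `S_1, …, S_w` be multisets of variables. Then there exists another occur-`k`
formula `G'` for which, the vector of polynomials `(Δ_{S_1} G, …, Δ_{S_w} G) = V_G · (Δ_{S_1} G', …,
Δ_{S_w} G')` such that
* If `G` is a `+` gate then `G'` is also a `+` gate whose children consist of at most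
  `k · |⋃_i var(S_i)|` of the children of `G`, and `V_G = 1`.
* If `G` is a `×∧` gate, then `G'` is also a `×∧` gate whose children consist of at most
  `k · |⋃_i var(S_i)|` of the children of `G`, and `V_G = G/G'`.
Further, the gates constituting `G'` and `V_G` are disjoint."
Printed proof (p0018:L43–L52): `G'` := the children of `G` that "depend on the variables present in
`⋃ var(S_i)`" (at most `k · |⋃ var(S_i)|` of them, `G` being a gate of an occur-`k` formula); for a
`+` gate "`Δ_{S_i} G = Δ_{S_i} G'` as the other gates are independent of the variables in `⋃ S_i`";
for a `×∧` gate `G = H_1^{e_1} ⋯ H_m^{e_m}`, "`G' := H_1^{e_1} ⋯ H_t^{e_t}` and `V_G := G/G'`. Then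
`Δ_{S_i} G = V_G · Δ_{S_i} G'`".

## Contents (the formula-model layer; the model-independent polynomial algebra of §7.3 is the
## sibling file `ASSS16DerivativeAlgebra` of the same push)

* M1 (occurrences control variables): `OccurFormula.not_mem_vars_of_occur_eq_zero` — a variable
  that occurs in no leaf of `φ` is not a variable of the computed polynomial `φ.eval` (and the
  `OccurArgs` / `OccurPowArgs` companions); this is "the other gates are independent of the
  variables in `⋃ S_i`".
* M2 (the selectors `G'`, `V_G` for a finite variable set `W = ⋃ var(S_i)`):
  `OccurFormula.occurIn W φ = Σ_{i ∈ W} occur_i φ` (so "`φ` depends on `W`" iff `occurIn W φ ≠ 0`),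
  `OccurArgs.restrict W` (the children of a `+` gate depending on `W` — the `+` gate `G'`),
  `OccurPowArgs.restrict W` (same for a `×∧` gate, exponent labels kept — the `×∧` gate `G'`) and
  `OccurPowArgs.corestrict W` (the complementary children — `V_G = G/G'`); the counting bound
  `length (restrict W) ≤ Σ_{i ∈ W} occur_i ≤ k · |W|`; `restrict` / `corestrict` do not increase
  occurrences, size or depth, and split the size and the occurrences of a `×∧` gate additively
  (the disjointness clause in bookkeeping form).
* M3 (Lemma 4.1, `+` gate, `V_G = 1`): `OccurArgs.iterPderiv_evalSum_eq_restrict`.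
* M4 (Lemma 4.1, `×∧` gate, `V_G = G/G'`): `OccurPowArgs.evalProd_eq_corestrict_mul_restrict`,
  `OccurPowArgs.not_mem_vars_evalProd_corestrict`, `OccurPowArgs.iterPderiv_evalProd_eq`.

Honest framing: infrastructure for the val-lit N1 push (bypass of FSV Thm. 48 via
`FSV2018_thm48_topFanIn`, plan HOME/np/p1g3-THM48-provenance-and-plan.md, steps F2–F4); nothing
here bears on `VP ≠ VNP`, which is NOT proved.

## References
* [AgrawalEtAl2011] M. Agrawal, C. Saha, R. Saptharishi, N. Saxena, *Jacobian hits circuits: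
  Hitting-sets, lower bounds for depth-D occur-k formulas & depth-3 transcendence degree-k
  circuits*, arXiv:1111.0582 (STOC 2012; SIAM J. Comput. 45 (2016)). Lemma 4.1 = §7.3
  `lem:derivative-content`. locator: paper:arxiv-1111.0582 p0009.txt:L48–L66, p0018.txt:L30–L52.
* [ForbesShpilkaVolk2018] M. Forbes, A. Shpilka, B. L. Volk, *Succinct hitting sets and barriers to
  proving lower bounds for algebraic circuits*, Theory of Computing 14 (2018), Def. 45 (seq.) =
  ToC Def. 5.21 (the occur-`k` formula model typed in `FSV18SuccinctGenerators`).
-/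

noncomputable section

namespace Literature.Computability.AlgebraicComplexity

open MvPolynomial Finset

/-! ### M1. Occurrences control the variables of the computed polynomial -/

section Bridge

variable {F : Type*} [CommSemiring F] {ι : Type*}

mutual
/-- **"The other gates are independent of the variables in `⋃ S_i`"** ([ASSS16] proof of Lemma 4.1,
§7.3): if `X_i` occurs in no leaf of the occur formula `φ` (FSV Def. 45: `occur_i φ = 0`) then `X_i`
is not a variable of the polynomial `φ` computes. (The converse fails: occurrences may cancel.)
[cite: AgrawalEtAl2011, Lemma 4.1 (proof, §7.3 lem:derivative-content)]
locator: paper:arxiv-1111.0582 p0018.txt:L43–L47 -/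
theorem OccurFormula.not_mem_vars_of_occur_eq_zero :
    ∀ (φ : OccurFormula F ι) (i : ι), φ.occur i = 0 → i ∉ φ.eval.vars
  | .leaf p, i, h => by
    rw [OccurFormula.eval]
    rw [OccurFormula.occur] at h
    intro hi
    rw [mem_vars_iff_degreeOf_ne_zero] at hi
    rw [if_neg hi] at h
    exact one_ne_zero h
  | .add as, i, h => by
    rw [OccurFormula.eval]
    rw [OccurFormula.occur] at h
    exact OccurArgs.not_mem_vars_of_occur_eq_zero as i h
  | .powProd ps, i, h => by
    rw [OccurFormula.eval]
    rw [OccurFormula.occur] at h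
    exact OccurPowArgs.not_mem_vars_of_occur_eq_zero ps i h

/-- `+`-argument lists: a variable occurring in none of the arguments' leaves is not a variable of
their sum. [cite: AgrawalEtAl2011, Lemma 4.1 (proof, §7.3 lem:derivative-content)] -/
theorem OccurArgs.not_mem_vars_of_occur_eq_zero :
    ∀ (as : OccurArgs F ι) (i : ι), as.occur i = 0 → i ∉ as.evalSum.vars
  | .nil, i, _ => by
    rw [OccurArgs.evalSum, vars_0]
    exact Finset.notMem_empty i
  | .cons φ as, i, h => by
    classical
    rw [OccurArgs.evalSum]
    rw [OccurArgs.occur] at h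
    intro hi
    rcases Finset.mem_union.1 (vars_add_subset _ _ hi) with h1 | h2
    · exact OccurFormula.not_mem_vars_of_occur_eq_zero φ i (by omega) h1
    · exact OccurArgs.not_mem_vars_of_occur_eq_zero as i (by omega) h2

/-- `×∧`-argument lists: a variable occurring in none of the arguments' leaves is not a variable
of their power product. [cite: AgrawalEtAl2011, Lemma 4.1 (proof, §7.3 lem:derivative-content)] -/
theorem OccurPowArgs.not_mem_vars_of_occur_eq_zero :
    ∀ (ps : OccurPowArgs F ι) (i : ι), ps.occur i = 0 → i ∉ ps.evalProd.vars
  | .nil, i, _ => by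
    rw [OccurPowArgs.evalProd, ← C_1, vars_C]
    exact Finset.notMem_empty i
  | .cons φ e ps, i, h => by
    classical
    rw [OccurPowArgs.evalProd]
    rw [OccurPowArgs.occur] at h
    intro hi
    rcases Finset.mem_union.1 (vars_mul _ _ hi) with h1 | h2
    · exact OccurFormula.not_mem_vars_of_occur_eq_zero φ i (by omega) (vars_pow _ _ h1)
    · exact OccurPowArgs.not_mem_vars_of_occur_eq_zero ps i (by omega) h2
end

/-- Contrapositive of `OccurFormula.not_mem_vars_of_occur_eq_zero`: a variable of the computed
polynomial occurs in some leaf. [cite: AgrawalEtAl2011, Lemma 4.1 (proof, §7.3 lem:derivative-content)] -/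
theorem OccurFormula.occur_ne_zero_of_mem_vars {φ : OccurFormula F ι} {i : ι}
    (h : i ∈ φ.eval.vars) : φ.occur i ≠ 0 :=
  fun h0 => OccurFormula.not_mem_vars_of_occur_eq_zero φ i h0 h

/-- The variables of the computed polynomial are among the occurring variables.
[cite: AgrawalEtAl2011, Lemma 4.1 (proof, §7.3 lem:derivative-content)] -/
theorem OccurFormula.vars_eval_subset_of_occur {φ : OccurFormula F ι} {W : Finset ι}
    (h : ∀ i, φ.occur i ≠ 0 → i ∈ W) : φ.eval.vars ⊆ W :=
  fun _ hi => h _ (OccurFormula.occur_ne_zero_of_mem_vars hi)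

end Bridge

/-! ### M2. The selectors `G'` and `V_G` of Lemma 4.1 -/

section Selectors

variable {F : Type*} [CommSemiring F] {ι : Type*}

/-- **Occurrences of the variables of `W` in `φ`**: `Σ_{i ∈ W} occur_i φ`. A child "depends on the
variables present in `W = ⋃ var(S_i)`" ([ASSS16] §7.3, proof of Lemma 4.1; syntactic reading: some
variable of `W` occurs in a leaf of the child) iff `occurIn W φ ≠ 0`.
[cite: AgrawalEtAl2011, Lemma 4.1 (proof, §7.3 lem:derivative-content)]
locator: paper:arxiv-1111.0582 p0018.txt:L43–L45 -/
def OccurFormula.occurIn (W : Finset ι) (φ : OccurFormula F ι) : ℕ := ∑ i ∈ W, φ.occur i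

/-- `occurIn W φ = 0` iff no variable of `W` occurs in `φ`. [cite: AgrawalEtAl2011, Lemma 4.1 (proof, §7.3 lem:derivative-content)] -/
theorem OccurFormula.occurIn_eq_zero_iff {W : Finset ι} {φ : OccurFormula F ι} :
    φ.occurIn W = 0 ↔ ∀ i ∈ W, φ.occur i = 0 :=
  Finset.sum_eq_zero_iff

/-- Monotonicity of `occurIn` in the variable set. [cite: AgrawalEtAl2011, Lemma 4.1 (proof, §7.3 lem:derivative-content)] -/
theorem OccurFormula.occurIn_eq_zero_of_subset {W W' : Finset ι} (hW : W' ⊆ W) {φ : OccurFormula F ι}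
    (h : φ.occurIn W = 0) : φ.occurIn W' = 0 :=
  OccurFormula.occurIn_eq_zero_iff.2 fun i hi => OccurFormula.occurIn_eq_zero_iff.1 h i (hW hi)

/-- A child not depending on `W` computes a polynomial free of the variables of `W` ("the other
gates are independent of the variables in `⋃ S_i`"). [cite: AgrawalEtAl2011, Lemma 4.1 (proof, §7.3 lem:derivative-content)] -/
theorem OccurFormula.not_mem_vars_of_occurIn_eq_zero {W : Finset ι} {φ : OccurFormula F ι}
    (h : φ.occurIn W = 0) {i : ι} (hi : i ∈ W) : i ∉ φ.eval.vars :=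
  OccurFormula.not_mem_vars_of_occur_eq_zero φ i (OccurFormula.occurIn_eq_zero_iff.1 h i hi)

/-- **`G'` for a `+` gate**: the sub-list of the children that depend on the variables of `W`
("let `G'` be the sum of these children", [ASSS16] §7.3).
[cite: AgrawalEtAl2011, Lemma 4.1 (proof, §7.3 lem:derivative-content)]
locator: paper:arxiv-1111.0582 p0018.txt:L43–L45 -/
def OccurArgs.restrict (W : Finset ι) : OccurArgs F ι → OccurArgs F ι
  | .nil => .nil
  | .cons φ as =>
    if φ.occurIn W = 0 then OccurArgs.restrict W as else .cons φ (OccurArgs.restrict W as)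

/-- The number of children of a `×∧` gate (companion of `OccurArgs.length`).
[cite: ForbesShpilkaVolk2018, Def. 45 (seq.) = ToC Def. 5.21, p. 29] -/
def OccurPowArgs.length : OccurPowArgs F ι → ℕ
  | .nil => 0
  | .cons _ _ ps => OccurPowArgs.length ps + 1

/-- **`G'` for a `×∧` gate**: the children (with their exponent labels) that depend on the
variables of `W` ("call these `H_1, …, H_t`. Let `G' := H_1^{e_1} ⋯ H_t^{e_t}`", [ASSS16] §7.3).
[cite: AgrawalEtAl2011, Lemma 4.1 (proof, §7.3 lem:derivative-content)]
locator: paper:arxiv-1111.0582 p0018.txt:L48–L52 -/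
def OccurPowArgs.restrict (W : Finset ι) : OccurPowArgs F ι → OccurPowArgs F ι
  | .nil => .nil
  | .cons φ e ps =>
    if φ.occurIn W = 0 then OccurPowArgs.restrict W ps else .cons φ e (OccurPowArgs.restrict W ps)

/-- **`V_G = G/G'` for a `×∧` gate**: the children (with their exponent labels) that do NOT depend
on the variables of `W`. [cite: AgrawalEtAl2011, Lemma 4.1 (proof, §7.3 lem:derivative-content)]
locator: paper:arxiv-1111.0582 p0018.txt:L48–L52 -/
def OccurPowArgs.corestrict (W : Finset ι) : OccurPowArgs F ι → OccurPowArgs F ι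
  | .nil => .nil
  | .cons φ e ps =>
    if φ.occurIn W = 0 then .cons φ e (OccurPowArgs.corestrict W ps) else OccurPowArgs.corestrict W ps

/-! #### Unfolding lemmas -/

/-- Unfolding: the empty `+`-argument list has no child depending on `W`. [cite: AgrawalEtAl2011, Lemma 4.1 (proof, §7.3 lem:derivative-content)] -/
@[simp] theorem OccurArgs.restrict_nil (W : Finset ι) :
    (OccurArgs.nil : OccurArgs F ι).restrict W = .nil := rfl

/-- Unfolding: a child not depending on `W` is dropped by `restrict W`. [cite: AgrawalEtAl2011, Lemma 4.1 (proof, §7.3 lem:derivative-content)] -/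
theorem OccurArgs.restrict_cons_of_eq_zero (W : Finset ι) {φ : OccurFormula F ι} (as : OccurArgs F ι)
    (h : φ.occurIn W = 0) : (OccurArgs.cons φ as).restrict W = as.restrict W := by
  rw [OccurArgs.restrict, if_pos h]

/-- Unfolding: a child depending on `W` is kept by `restrict W`. [cite: AgrawalEtAl2011, Lemma 4.1 (proof, §7.3 lem:derivative-content)] -/
theorem OccurArgs.restrict_cons_of_ne_zero (W : Finset ι) {φ : OccurFormula F ι} (as : OccurArgs F ι)
    (h : φ.occurIn W ≠ 0) : (OccurArgs.cons φ as).restrict W = .cons φ (as.restrict W) := by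
  rw [OccurArgs.restrict, if_neg h]

/-- Unfolding: the empty `×∧`-argument list has no child depending on `W`. [cite: AgrawalEtAl2011, Lemma 4.1 (proof, §7.3 lem:derivative-content)] -/
@[simp] theorem OccurPowArgs.restrict_nil (W : Finset ι) :
    (OccurPowArgs.nil : OccurPowArgs F ι).restrict W = .nil := rfl

/-- Unfolding: a child not depending on `W` is dropped by `restrict W` (×∧). [cite: AgrawalEtAl2011, Lemma 4.1 (proof, §7.3 lem:derivative-content)] -/
theorem OccurPowArgs.restrict_cons_of_eq_zero (W : Finset ι) {φ : OccurFormula F ι} (e : ℕ)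
    (ps : OccurPowArgs F ι) (h : φ.occurIn W = 0) :
    (OccurPowArgs.cons φ e ps).restrict W = ps.restrict W := by
  rw [OccurPowArgs.restrict, if_pos h]

/-- Unfolding: a child depending on `W` is kept by `restrict W` (×∧). [cite: AgrawalEtAl2011, Lemma 4.1 (proof, §7.3 lem:derivative-content)] -/
theorem OccurPowArgs.restrict_cons_of_ne_zero (W : Finset ι) {φ : OccurFormula F ι} (e : ℕ)
    (ps : OccurPowArgs F ι) (h : φ.occurIn W ≠ 0) :
    (OccurPowArgs.cons φ e ps).restrict W = .cons φ e (ps.restrict W) := by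
  rw [OccurPowArgs.restrict, if_neg h]

/-- Unfolding: the empty `×∧`-argument list has no child free of `W`. [cite: AgrawalEtAl2011, Lemma 4.1 (proof, §7.3 lem:derivative-content)] -/
@[simp] theorem OccurPowArgs.corestrict_nil (W : Finset ι) :
    (OccurPowArgs.nil : OccurPowArgs F ι).corestrict W = .nil := rfl

/-- Unfolding: a child not depending on `W` is kept by `corestrict W`. [cite: AgrawalEtAl2011, Lemma 4.1 (proof, §7.3 lem:derivative-content)] -/
theorem OccurPowArgs.corestrict_cons_of_eq_zero (W : Finset ι) {φ : OccurFormula F ι} (e : ℕ)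
    (ps : OccurPowArgs F ι) (h : φ.occurIn W = 0) :
    (OccurPowArgs.cons φ e ps).corestrict W = .cons φ e (ps.corestrict W) := by
  rw [OccurPowArgs.corestrict, if_pos h]

/-- Unfolding: a child depending on `W` is dropped by `corestrict W`. [cite: AgrawalEtAl2011, Lemma 4.1 (proof, §7.3 lem:derivative-content)] -/
theorem OccurPowArgs.corestrict_cons_of_ne_zero (W : Finset ι) {φ : OccurFormula F ι} (e : ℕ)
    (ps : OccurPowArgs F ι) (h : φ.occurIn W ≠ 0) :
    (OccurPowArgs.cons φ e ps).corestrict W = ps.corestrict W := by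
  rw [OccurPowArgs.corestrict, if_neg h]

/-! #### Counting: "at most `k · |⋃ var(S_i)|` of its children depend on the variables" -/

/-- The number of children of a `+` gate depending on `W` is at most the number of occurrences of
the variables of `W` among the children. [cite: AgrawalEtAl2011, Lemma 4.1 (proof, §7.3 lem:derivative-content)]
locator: paper:arxiv-1111.0582 p0018.txt:L43–L45 -/
theorem OccurArgs.length_restrict_le_sum_occur (W : Finset ι) :
    ∀ as : OccurArgs F ι, (as.restrict W).length ≤ ∑ i ∈ W, as.occur i
  | .nil => by simp [OccurArgs.length]
  | .cons φ as => by
    have ih := OccurArgs.length_restrict_le_sum_occur W as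
    have hsum : ∑ i ∈ W, (OccurArgs.cons φ as).occur i = φ.occurIn W + ∑ i ∈ W, as.occur i := by
      simp only [OccurArgs.occur, OccurFormula.occurIn, Finset.sum_add_distrib]
    rw [hsum]
    by_cases h : φ.occurIn W = 0
    · rw [OccurArgs.restrict_cons_of_eq_zero W as h]
      omega
    · rw [OccurArgs.restrict_cons_of_ne_zero W as h, OccurArgs.length]
      omega

/-- **Lemma 4.1, `+` gate, the count**: in an occur-`k` formula at most `k · |W|` children of a
`+` gate depend on the variables of `W`. [cite: AgrawalEtAl2011, Lemma 4.1 (first bullet)]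
locator: paper:arxiv-1111.0582 p0009.txt:L58–L61 -/
theorem OccurArgs.length_restrict_le (W : Finset ι) {k : ℕ} (as : OccurArgs F ι)
    (hk : ∀ i, as.occur i ≤ k) : (as.restrict W).length ≤ k * W.card := by
  refine (OccurArgs.length_restrict_le_sum_occur W as).trans ?_
  calc ∑ i ∈ W, as.occur i ≤ ∑ _i ∈ W, k := Finset.sum_le_sum fun i _ => hk i
    _ = k * W.card := by rw [Finset.sum_const, smul_eq_mul, mul_comm]

/-- The number of children of a `×∧` gate depending on `W` is at most the number of occurrences
of the variables of `W` among the children. [cite: AgrawalEtAl2011, Lemma 4.1 (proof, §7.3 lem:derivative-content)]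
locator: paper:arxiv-1111.0582 p0018.txt:L48–L50 -/
theorem OccurPowArgs.length_restrict_le_sum_occur (W : Finset ι) :
    ∀ ps : OccurPowArgs F ι, (ps.restrict W).length ≤ ∑ i ∈ W, ps.occur i
  | .nil => by simp [OccurPowArgs.length]
  | .cons φ e ps => by
    have ih := OccurPowArgs.length_restrict_le_sum_occur W ps
    have hsum : ∑ i ∈ W, (OccurPowArgs.cons φ e ps).occur i = φ.occurIn W + ∑ i ∈ W, ps.occur i := by
      simp only [OccurPowArgs.occur, OccurFormula.occurIn, Finset.sum_add_distrib]
    rw [hsum]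
    by_cases h : φ.occurIn W = 0
    · rw [OccurPowArgs.restrict_cons_of_eq_zero W e ps h]
      omega
    · rw [OccurPowArgs.restrict_cons_of_ne_zero W e ps h, OccurPowArgs.length]
      omega

/-- **Lemma 4.1, `×∧` gate, the count**: in an occur-`k` formula at most `k · |W|` children of a
`×∧` gate depend on the variables of `W`. [cite: AgrawalEtAl2011, Lemma 4.1 (second bullet)]
locator: paper:arxiv-1111.0582 p0009.txt:L62–L65 -/
theorem OccurPowArgs.length_restrict_le (W : Finset ι) {k : ℕ} (ps : OccurPowArgs F ι)
    (hk : ∀ i, ps.occur i ≤ k) : (ps.restrict W).length ≤ k * W.card := by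
  refine (OccurPowArgs.length_restrict_le_sum_occur W ps).trans ?_
  calc ∑ i ∈ W, ps.occur i ≤ ∑ _i ∈ W, k := Finset.sum_le_sum fun i _ => hk i
    _ = k * W.card := by rw [Finset.sum_const, smul_eq_mul, mul_comm]

/-! #### `G'` and `V_G` are again occur formulas with the same resource bounds -/

/-- `restrict` keeps at most all children. [cite: AgrawalEtAl2011, Lemma 4.1 (proof, §7.3 lem:derivative-content)] -/
theorem OccurArgs.length_restrict_le_length (W : Finset ι) :
    ∀ as : OccurArgs F ι, (as.restrict W).length ≤ as.length
  | .nil => by simp [OccurArgs.length]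
  | .cons φ as => by
    have ih := OccurArgs.length_restrict_le_length W as
    by_cases h : φ.occurIn W = 0
    · rw [OccurArgs.restrict_cons_of_eq_zero W as h, OccurArgs.length]; omega
    · rw [OccurArgs.restrict_cons_of_ne_zero W as h, OccurArgs.length, OccurArgs.length]; omega

/-- `restrict` does not increase occurrences. [cite: AgrawalEtAl2011, Lemma 4.1 (proof, §7.3 lem:derivative-content)] -/
theorem OccurArgs.occur_restrict_le (W : Finset ι) (i : ι) :
    ∀ as : OccurArgs F ι, (as.restrict W).occur i ≤ as.occur i
  | .nil => by simp [OccurArgs.occur]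
  | .cons φ as => by
    have ih := OccurArgs.occur_restrict_le W i as
    by_cases h : φ.occurIn W = 0
    · rw [OccurArgs.restrict_cons_of_eq_zero W as h, OccurArgs.occur]; omega
    · rw [OccurArgs.restrict_cons_of_ne_zero W as h, OccurArgs.occur, OccurArgs.occur]; omega

/-- `restrict` does not increase size. [cite: AgrawalEtAl2011, Lemma 4.1 (proof, §7.3 lem:derivative-content)] -/
theorem OccurArgs.size_restrict_le (W : Finset ι) :
    ∀ as : OccurArgs F ι, (as.restrict W).size ≤ as.size
  | .nil => by simp [OccurArgs.size]
  | .cons φ as => by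
    have ih := OccurArgs.size_restrict_le W as
    by_cases h : φ.occurIn W = 0
    · rw [OccurArgs.restrict_cons_of_eq_zero W as h, OccurArgs.size]; omega
    · rw [OccurArgs.restrict_cons_of_ne_zero W as h, OccurArgs.size, OccurArgs.size]; omega

/-- `restrict` does not increase depth. [cite: AgrawalEtAl2011, Lemma 4.1 (proof, §7.3 lem:derivative-content)] -/
theorem OccurArgs.depth_restrict_le (W : Finset ι) :
    ∀ as : OccurArgs F ι, (as.restrict W).depth ≤ as.depth
  | .nil => by simp [OccurArgs.depth]
  | .cons φ as => by
    have ih := OccurArgs.depth_restrict_le W as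
    by_cases h : φ.occurIn W = 0
    · rw [OccurArgs.restrict_cons_of_eq_zero W as h, OccurArgs.depth]
      exact ih.trans (le_max_right _ _)
    · rw [OccurArgs.restrict_cons_of_ne_zero W as h, OccurArgs.depth, OccurArgs.depth]
      exact max_le_max le_rfl ih

/-- Every child kept by `restrict W` depends on `W`: restricting again to `W` changes nothing.
[cite: AgrawalEtAl2011, Lemma 4.1 (proof, §7.3 lem:derivative-content)] -/
theorem OccurArgs.restrict_restrict_of_subset {W W' : Finset ι} (hW : W' ⊆ W) :
    ∀ as : OccurArgs F ι, (as.restrict W).restrict W' = as.restrict W'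
  | .nil => rfl
  | .cons φ as => by
    have ih := OccurArgs.restrict_restrict_of_subset hW as
    by_cases h : φ.occurIn W = 0
    · rw [OccurArgs.restrict_cons_of_eq_zero W as h,
        OccurArgs.restrict_cons_of_eq_zero W' as (OccurFormula.occurIn_eq_zero_of_subset hW h), ih]
    · rw [OccurArgs.restrict_cons_of_ne_zero W as h]
      by_cases h' : φ.occurIn W' = 0
      · rw [OccurArgs.restrict_cons_of_eq_zero W' _ h', OccurArgs.restrict_cons_of_eq_zero W' _ h', ih]
      · rw [OccurArgs.restrict_cons_of_ne_zero W' _ h', OccurArgs.restrict_cons_of_ne_zero W' _ h', ih]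

/-- The children of a `×∧` gate split into those depending on `W` and the others (count).
[cite: AgrawalEtAl2011, Lemma 4.1 ("the gates constituting G' and V_G are disjoint")]
locator: paper:arxiv-1111.0582 p0009.txt:L66 -/
theorem OccurPowArgs.length_restrict_add_length_corestrict (W : Finset ι) :
    ∀ ps : OccurPowArgs F ι, (ps.restrict W).length + (ps.corestrict W).length = ps.length
  | .nil => by simp [OccurPowArgs.length]
  | .cons φ e ps => by
    have ih := OccurPowArgs.length_restrict_add_length_corestrict W ps
    by_cases h : φ.occurIn W = 0
    · rw [OccurPowArgs.restrict_cons_of_eq_zero W e ps h, OccurPowArgs.corestrict_cons_of_eq_zero W e ps h,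
        OccurPowArgs.length, OccurPowArgs.length]; omega
    · rw [OccurPowArgs.restrict_cons_of_ne_zero W e ps h, OccurPowArgs.corestrict_cons_of_ne_zero W e ps h,
        OccurPowArgs.length, OccurPowArgs.length]; omega

/-- **"The gates constituting `G'` and `V_G` are disjoint"**, size bookkeeping: the sizes of
`G'` and of `V_G` add up to the size of the `×∧` gate `G`.
[cite: AgrawalEtAl2011, Lemma 4.1 (last clause)] locator: paper:arxiv-1111.0582 p0009.txt:L66 -/
theorem OccurPowArgs.size_restrict_add_size_corestrict (W : Finset ι) :
    ∀ ps : OccurPowArgs F ι, (ps.restrict W).size + (ps.corestrict W).size = ps.size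
  | .nil => by simp [OccurPowArgs.size]
  | .cons φ e ps => by
    have ih := OccurPowArgs.size_restrict_add_size_corestrict W ps
    by_cases h : φ.occurIn W = 0
    · rw [OccurPowArgs.restrict_cons_of_eq_zero W e ps h, OccurPowArgs.corestrict_cons_of_eq_zero W e ps h,
        OccurPowArgs.size, OccurPowArgs.size]; omega
    · rw [OccurPowArgs.restrict_cons_of_ne_zero W e ps h, OccurPowArgs.corestrict_cons_of_ne_zero W e ps h,
        OccurPowArgs.size, OccurPowArgs.size]; omega

/-- Occurrences split additively between `G'` and `V_G`.
[cite: AgrawalEtAl2011, Lemma 4.1 (last clause)] locator: paper:arxiv-1111.0582 p0009.txt:L66 -/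
theorem OccurPowArgs.occur_restrict_add_occur_corestrict (W : Finset ι) (i : ι) :
    ∀ ps : OccurPowArgs F ι, (ps.restrict W).occur i + (ps.corestrict W).occur i = ps.occur i
  | .nil => by simp [OccurPowArgs.occur]
  | .cons φ e ps => by
    have ih := OccurPowArgs.occur_restrict_add_occur_corestrict W i ps
    by_cases h : φ.occurIn W = 0
    · rw [OccurPowArgs.restrict_cons_of_eq_zero W e ps h, OccurPowArgs.corestrict_cons_of_eq_zero W e ps h,
        OccurPowArgs.occur, OccurPowArgs.occur]; omega
    · rw [OccurPowArgs.restrict_cons_of_ne_zero W e ps h, OccurPowArgs.corestrict_cons_of_ne_zero W e ps h,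
        OccurPowArgs.occur, OccurPowArgs.occur]; omega

/-- `restrict` does not increase the occurrences of a `×∧` gate. [cite: AgrawalEtAl2011, Lemma 4.1 (proof, §7.3 lem:derivative-content)] -/
theorem OccurPowArgs.occur_restrict_le (W : Finset ι) (i : ι) (ps : OccurPowArgs F ι) :
    (ps.restrict W).occur i ≤ ps.occur i := by
  have := OccurPowArgs.occur_restrict_add_occur_corestrict W i ps; omega

/-- `restrict` does not increase the size of a `×∧` gate. [cite: AgrawalEtAl2011, Lemma 4.1 (proof, §7.3 lem:derivative-content)] -/
theorem OccurPowArgs.size_restrict_le (W : Finset ι) (ps : OccurPowArgs F ι) :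
    (ps.restrict W).size ≤ ps.size := by
  have := OccurPowArgs.size_restrict_add_size_corestrict W ps; omega

/-- `corestrict` does not increase the size of a `×∧` gate. [cite: AgrawalEtAl2011, Lemma 4.1 (proof, §7.3 lem:derivative-content)] -/
theorem OccurPowArgs.size_corestrict_le (W : Finset ι) (ps : OccurPowArgs F ι) :
    (ps.corestrict W).size ≤ ps.size := by
  have := OccurPowArgs.size_restrict_add_size_corestrict W ps; omega

/-- `restrict` does not increase the depth of a `×∧` gate. [cite: AgrawalEtAl2011, Lemma 4.1 (proof, §7.3 lem:derivative-content)] -/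
theorem OccurPowArgs.depth_restrict_le (W : Finset ι) :
    ∀ ps : OccurPowArgs F ι, (ps.restrict W).depth ≤ ps.depth
  | .nil => by simp [OccurPowArgs.depth]
  | .cons φ e ps => by
    have ih := OccurPowArgs.depth_restrict_le W ps
    by_cases h : φ.occurIn W = 0
    · rw [OccurPowArgs.restrict_cons_of_eq_zero W e ps h, OccurPowArgs.depth]
      exact ih.trans (le_max_right _ _)
    · rw [OccurPowArgs.restrict_cons_of_ne_zero W e ps h, OccurPowArgs.depth, OccurPowArgs.depth]
      exact max_le_max le_rfl ih

/-- `corestrict` does not increase the depth of a `×∧` gate. [cite: AgrawalEtAl2011, Lemma 4.1 (proof, §7.3 lem:derivative-content)] -/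
theorem OccurPowArgs.depth_corestrict_le (W : Finset ι) :
    ∀ ps : OccurPowArgs F ι, (ps.corestrict W).depth ≤ ps.depth
  | .nil => by simp [OccurPowArgs.depth]
  | .cons φ e ps => by
    have ih := OccurPowArgs.depth_corestrict_le W ps
    by_cases h : φ.occurIn W = 0
    · rw [OccurPowArgs.corestrict_cons_of_eq_zero W e ps h, OccurPowArgs.depth, OccurPowArgs.depth]
      exact max_le_max le_rfl ih
    · rw [OccurPowArgs.corestrict_cons_of_ne_zero W e ps h, OccurPowArgs.depth]
      exact ih.trans (le_max_right _ _)

/-- Every child kept by `restrict W` depends on `W` (×∧ gates).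
[cite: AgrawalEtAl2011, Lemma 4.1 (proof, §7.3 lem:derivative-content)] -/
theorem OccurPowArgs.restrict_restrict_of_subset {W W' : Finset ι} (hW : W' ⊆ W) :
    ∀ ps : OccurPowArgs F ι, (ps.restrict W).restrict W' = ps.restrict W'
  | .nil => rfl
  | .cons φ e ps => by
    have ih := OccurPowArgs.restrict_restrict_of_subset hW ps
    by_cases h : φ.occurIn W = 0
    · rw [OccurPowArgs.restrict_cons_of_eq_zero W e ps h,
        OccurPowArgs.restrict_cons_of_eq_zero W' e ps (OccurFormula.occurIn_eq_zero_of_subset hW h), ih]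
    · rw [OccurPowArgs.restrict_cons_of_ne_zero W e ps h]
      by_cases h' : φ.occurIn W' = 0
      · rw [OccurPowArgs.restrict_cons_of_eq_zero W' e _ h', OccurPowArgs.restrict_cons_of_eq_zero W' e _ h', ih]
      · rw [OccurPowArgs.restrict_cons_of_ne_zero W' e _ h', OccurPowArgs.restrict_cons_of_ne_zero W' e _ h', ih]

/-- No variable of `W` occurs in `V_G`. [cite: AgrawalEtAl2011, Lemma 4.1 (proof, §7.3 lem:derivative-content)]
locator: paper:arxiv-1111.0582 p0018.txt:L48–L52 -/
theorem OccurPowArgs.occur_corestrict_eq_zero (W : Finset ι) {i : ι} (hi : i ∈ W) :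
    ∀ ps : OccurPowArgs F ι, (ps.corestrict W).occur i = 0
  | .nil => by simp [OccurPowArgs.occur]
  | .cons φ e ps => by
    have ih := OccurPowArgs.occur_corestrict_eq_zero W hi ps
    by_cases h : φ.occurIn W = 0
    · rw [OccurPowArgs.corestrict_cons_of_eq_zero W e ps h, OccurPowArgs.occur, ih,
        OccurFormula.occurIn_eq_zero_iff.1 h i hi]
    · rw [OccurPowArgs.corestrict_cons_of_ne_zero W e ps h, ih]

/-! #### `V_G = G/G'` as a factorisation of the computed polynomial -/

/-- **`G = V_G · G'`** for a `×∧` gate: the power product splits along the selector.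
[cite: AgrawalEtAl2011, Lemma 4.1 (second bullet: "V_G = G/G'")]
locator: paper:arxiv-1111.0582 p0018.txt:L50–L52 -/
theorem OccurPowArgs.evalProd_eq_corestrict_mul_restrict (W : Finset ι) :
    ∀ ps : OccurPowArgs F ι, ps.evalProd = (ps.corestrict W).evalProd * (ps.restrict W).evalProd
  | .nil => by simp [OccurPowArgs.evalProd]
  | .cons φ e ps => by
    have ih := OccurPowArgs.evalProd_eq_corestrict_mul_restrict W ps
    by_cases h : φ.occurIn W = 0
    · rw [OccurPowArgs.restrict_cons_of_eq_zero W e ps h, OccurPowArgs.corestrict_cons_of_eq_zero W e ps h,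
        OccurPowArgs.evalProd, OccurPowArgs.evalProd, ih]
      ring
    · rw [OccurPowArgs.restrict_cons_of_ne_zero W e ps h, OccurPowArgs.corestrict_cons_of_ne_zero W e ps h,
        OccurPowArgs.evalProd, OccurPowArgs.evalProd, ih]
      ring

/-- `V_G` is free of the variables of `W`. [cite: AgrawalEtAl2011, Lemma 4.1 (proof, §7.3 lem:derivative-content)]
locator: paper:arxiv-1111.0582 p0018.txt:L48–L52 -/
theorem OccurPowArgs.not_mem_vars_evalProd_corestrict (W : Finset ι) {i : ι} (hi : i ∈ W)
    (ps : OccurPowArgs F ι) : i ∉ (ps.corestrict W).evalProd.vars :=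
  OccurPowArgs.not_mem_vars_of_occur_eq_zero _ i (OccurPowArgs.occur_corestrict_eq_zero W hi ps)

end Selectors

/-! ### M3–M4. Lemma 4.1: the derivative identities (`Δ_S = iterPderiv β`, `var(S) = β.support`) -/

section Derivatives

open Literature.RepresentationTheory.AlgebraicGroups

variable {F : Type*} [CommRing F] {ι : Type*}

/-- `∂_i^n (c · g) = c · ∂_i^n g` for `X_i` not a variable of `c` ("use properties of derivation",
[ASSS16] Lemma 4.1, proof pointer). Local stand-in for the model-independent algebra of the sibling
file `ASSS16DerivativeAlgebra` of this push. [cite: AgrawalEtAl2011, Lemma 4.1 (proof)] -/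
private theorem iterPderiv_single_mul_left_aux (i : ι) {c : MvPolynomial ι F} (hc : i ∉ c.vars) :
    ∀ (n : ℕ) (g : MvPolynomial ι F),
      iterPderiv (Finsupp.single i n) (c * g) = c * iterPderiv (Finsupp.single i n) g
  | 0, g => by simp [iterPderiv_zero]
  | n + 1, g => by
    have ih := iterPderiv_single_mul_left_aux i hc n
    rw [Finsupp.single_add, iterPderiv_add, LinearMap.comp_apply, LinearMap.comp_apply,
      iterPderiv_single]
    simp only [Derivation.coeFn_coe]
    rw [pderiv_mul, pderiv_eq_zero_of_notMem_vars hc, zero_mul, zero_add, ih]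

/-- `Δ_S (c · f) = c · Δ_S f` when no variable of `S` is a variable of `c`. Local stand-in (see
`iterPderiv_single_mul_left_aux`). [cite: AgrawalEtAl2011, Lemma 4.1 (proof)] -/
private theorem iterPderiv_mul_left_aux (β : ι →₀ ℕ) {c : MvPolynomial ι F}
    (hc : ∀ i ∈ β.support, i ∉ c.vars) (f : MvPolynomial ι F) :
    iterPderiv β (c * f) = c * iterPderiv β f := by
  induction β using Finsupp.induction generalizing f with
  | zero => simp [iterPderiv_zero]
  | single_add i n β' _ hn ih =>
    have hi' : i ∉ c.vars := hc i (by
      rw [Finsupp.mem_support_iff, Finsupp.add_apply, Finsupp.single_eq_same]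
      omega)
    have hβ' : ∀ j ∈ β'.support, j ∉ c.vars := fun j hj => hc j (by
      rw [Finsupp.mem_support_iff] at hj ⊢
      rw [Finsupp.add_apply]
      omega)
    rw [iterPderiv_add, LinearMap.comp_apply, LinearMap.comp_apply, ih hβ' f,
      iterPderiv_single_mul_left_aux i hi' n]

/-- `Δ_S 1 = 0` for `S ≠ ∅`. Local stand-in. [cite: AgrawalEtAl2011, Lemma 4.1 (proof)] -/
private theorem iterPderiv_one_eq_zero_aux {β : ι →₀ ℕ} (hβ : β ≠ 0) :
    iterPderiv β (1 : MvPolynomial ι F) = 0 := by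
  obtain ⟨q, hq⟩ := Finsupp.support_nonempty_iff.2 hβ
  have hw : iterPderivWeight β 0 = 0 := by
    rw [iterPderivWeight_eq_prod (0 : ι →₀ ℕ) (Finset.Subset.refl β.support)]
    refine Finset.prod_eq_zero hq ?_
    rw [Finsupp.coe_zero, Pi.zero_apply, Nat.descFactorial_eq_zero_iff_lt]
    exact Nat.pos_of_ne_zero (Finsupp.mem_support_iff.1 hq)
  rw [← C_1, C_apply, iterPderiv_monomial, hw, Nat.cast_zero, mul_zero, monomial_zero]

/-- `Δ_S c = 0` when `S ≠ ∅` and no variable of `S` is a variable of `c` ("the other gates are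
independent of the variables in `⋃ S_i`"). Local stand-in. [cite: AgrawalEtAl2011, Lemma 4.1 (proof)] -/
private theorem iterPderiv_eq_zero_aux {β : ι →₀ ℕ} (hβ : β ≠ 0) {c : MvPolynomial ι F}
    (hc : ∀ i ∈ β.support, i ∉ c.vars) : iterPderiv β c = 0 := by
  have h := iterPderiv_mul_left_aux β hc 1
  rwa [mul_one, iterPderiv_one_eq_zero_aux hβ, mul_zero] at h

/-- **[ASSS16] Lemma 4.1, `+` gate (`V_G = 1`)**: for every non-empty multiset `S` of variables
with `var(S) ⊆ W`, `Δ_S G = Δ_S G'` where `G'` is the sum of the children of the `+` gate `G`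
depending on `W` ("`Δ_{S_i} G = Δ_{S_i} G'` as the other gates are independent of the variables in
`⋃ S_i`"). With `W := ⋃_i var(S_i)` this is the printed vector identity, one coordinate at a time.
[cite: AgrawalEtAl2011, Lemma 4.1 (first bullet) = §7.3 lem:derivative-content]
locator: paper:arxiv-1111.0582 p0009.txt:L53–L61, p0018.txt:L43–L47 -/
theorem OccurArgs.iterPderiv_evalSum_eq_restrict (W : Finset ι) {β : ι →₀ ℕ} (hβ : β ≠ 0)
    (hW : β.support ⊆ W) :
    ∀ as : OccurArgs F ι, iterPderiv β as.evalSum = iterPderiv β (as.restrict W).evalSum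
  | .nil => by rw [OccurArgs.restrict_nil]
  | .cons φ as => by
    have ih := OccurArgs.iterPderiv_evalSum_eq_restrict W hβ hW as
    by_cases h : φ.occurIn W = 0
    · rw [OccurArgs.restrict_cons_of_eq_zero W as h, OccurArgs.evalSum, map_add, ih,
        iterPderiv_eq_zero_aux hβ (fun i hi => OccurFormula.not_mem_vars_of_occurIn_eq_zero h (hW hi)),
        zero_add]
    · rw [OccurArgs.restrict_cons_of_ne_zero W as h, OccurArgs.evalSum, OccurArgs.evalSum, map_add,
        map_add, ih]

/-- **[ASSS16] Lemma 4.1, `+` gate**, on the formula: `Δ_S (G) = Δ_S (G')` with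
`G' = OccurFormula.add (as.restrict W)`. [cite: AgrawalEtAl2011, Lemma 4.1 (first bullet)]
locator: paper:arxiv-1111.0582 p0009.txt:L53–L61 -/
theorem OccurFormula.iterPderiv_eval_add_eq_restrict (W : Finset ι) {β : ι →₀ ℕ} (hβ : β ≠ 0)
    (hW : β.support ⊆ W) (as : OccurArgs F ι) :
    iterPderiv β (OccurFormula.add as).eval = iterPderiv β (OccurFormula.add (as.restrict W)).eval := by
  rw [OccurFormula.eval, OccurFormula.eval]
  exact OccurArgs.iterPderiv_evalSum_eq_restrict W hβ hW as

/-- **[ASSS16] Lemma 4.1, `×∧` gate (`V_G = G/G'`)**: for every multiset `S` of variables with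
`var(S) ⊆ W`, `Δ_S G = V_G · Δ_S G'` where `G'` is the power product of the children of the `×∧`
gate `G` depending on `W` and `V_G` that of the others ("Let `G' := H_1^{e_1} ⋯ H_t^{e_t}` and
`V_G := G/G'`. Then, `Δ_{S_i} G = V_G · Δ_{S_i} G'`"). With `W := ⋃_i var(S_i)` this is the printed
vector identity, one coordinate at a time (also valid for `S = ∅`).
[cite: AgrawalEtAl2011, Lemma 4.1 (second bullet) = §7.3 lem:derivative-content]
locator: paper:arxiv-1111.0582 p0009.txt:L62–L66, p0018.txt:L48–L52 -/
theorem OccurPowArgs.iterPderiv_evalProd_eq (W : Finset ι) {β : ι →₀ ℕ} (hW : β.support ⊆ W)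
    (ps : OccurPowArgs F ι) :
    iterPderiv β ps.evalProd = (ps.corestrict W).evalProd * iterPderiv β (ps.restrict W).evalProd := by
  conv_lhs => rw [OccurPowArgs.evalProd_eq_corestrict_mul_restrict W ps]
  exact iterPderiv_mul_left_aux β
    (fun i hi => OccurPowArgs.not_mem_vars_evalProd_corestrict W (hW hi) ps) _

/-- **[ASSS16] Lemma 4.1, `×∧` gate**, on the formula: `Δ_S (G) = V_G · Δ_S (G')` with
`G' = OccurFormula.powProd (ps.restrict W)`, `V_G = (OccurFormula.powProd (ps.corestrict W)).eval`.
[cite: AgrawalEtAl2011, Lemma 4.1 (second bullet)] locator: paper:arxiv-1111.0582 p0009.txt:L62–L66 -/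
theorem OccurFormula.iterPderiv_eval_powProd_eq (W : Finset ι) {β : ι →₀ ℕ} (hW : β.support ⊆ W)
    (ps : OccurPowArgs F ι) :
    iterPderiv β (OccurFormula.powProd ps).eval =
      (OccurFormula.powProd (ps.corestrict W)).eval * iterPderiv β (OccurFormula.powProd (ps.restrict W)).eval := by
  rw [OccurFormula.eval, OccurFormula.eval, OccurFormula.eval]
  exact OccurPowArgs.iterPderiv_evalProd_eq W hW ps

end Derivatives

end Literature.Computability.AlgebraicComplexity
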